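import Summits.Ventures.HodgeRepro2.Tier7.Lit3

/-!
# Tier7/Lit3Cor — consequences of the displayed DR 2015 statements (t7-lit-3; proof lane, count-neutral)

Cell pub-hodge-repro2, Tier 7. Everything here is PROVED from the displays of `Tier7/Lit3.lean` (no new
Prop-valued def, no new axiom): the printed Theorem 3.2 of Dimitrov–Ramakrishnan 2015 (Doc. Math. 20 (2015)
1185–1205, p. 1195 ll. 18–31) implies, by (iv) then (iii), that EVERY automorphic representation `π` of the inner
form `G` with `π_ι = π⁺ or π⁻` and `π_v = 𝟙` at the other Archimedean places has global multiplicity `m(π) = 1`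
— i.e. multiplicity one for exactly the representations that build `H¹` of the compact Picard modular surface
(DR (3)/(5)/(9)/(10), blocks DR-2.1 / DR-2.2 of LIT-INDEX-lit-3.md). This is the inner-form multiplicity-one
statement the t7-lead's (H10) discussion asked for, in its PRINTED form for `H¹` (it says nothing about the
representations contributing to `H²`).

§8(d): uses an L-value-free non-vanishing device: NO.
-/

namespace Summit.Ventures.HodgeRepro2.Tier7

open DR2015Shape

/-- «π_ι = π⁺ or π⁻» read in `G′(F_ι) = U(2,1)` through `ident ι`, and «π_v = 𝟙 at all the Archimedean places
v ≠ ι» — the hypothesis of Theorem 3.2(iv) on `π`. -/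
def DR2015Shape.ContributesToH1 (S : DR2015Shape) (π : S.Rep) : Prop :=
  (S.ident S.ι (Or.inr rfl) (S.localComp π S.ι) = S.πplus S.ι S.ι_arch ∨
    S.ident S.ι (Or.inr rfl) (S.localComp π S.ι) = S.πminus S.ι S.ι_arch) ∧
  ∀ v, S.IsArch v → v ≠ S.ι → S.localComp π v = S.one v

/-- Multiplicity one on the inner form for the `H¹`-type representations: from Theorem 3.2(iv) (`π ∈ Π(λ,ν)` for
some `(λ,ν) ∈ Ξ`) and Theorem 3.2(iii) («Moreover, in this case the global multiplicity m(π) is 1»). -/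
theorem DR2015Shape.m_eq_one_of_thm3_2 (S : DR2015Shape) (h : Hyp.DR2015_Thm3_2 S) (π : S.Rep)
    (hπ : S.IsAutomorphic π) (hc : S.ContributesToH1 π) : S.m π = 1 := by
  obtain ⟨_, _, hiii, hiv⟩ := h
  obtain ⟨l, n, hΞ, hmem⟩ := hiv π hπ hc.1 hc.2
  exact (hiii l n hΞ π hmem).2 hπ

/-- The automorphy criterion itself, for such a `π` in its packet: `π` is automorphic iff
`W(λν_M) = (−1)^{d−1+s(π)}` (Theorem 3.2(iii), as displayed). -/
theorem DR2015Shape.isAutomorphic_iff_of_thm3_2 (S : DR2015Shape) (h : Hyp.DR2015_Thm3_2 S)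
    (l : S.HeckeChar) (n : S.NormOneChar) (hΞ : S.InXi l n) (π : S.Rep) (hmem : π ∈ S.Pi l n) :
    S.IsAutomorphic π ↔
      ShimuraData.RogawskiAutomorphyCondition (S.W l n) (S.d - 1) (S.sCount l n π) :=
  (h.2.2.1 l n hΞ π hmem).1

/-- Existence of an automorphic member with `m = 1` in every packet `Π(λ,ν)`, `(λ,ν) ∈ Ξ`, PROVIDED the packet
contains a member of each parity `s(π) ∈ {0, 1}` — the shape of the argument of Proposition 3.6 («if W(λ³) = (−1)^d
we choose a prime 𝔮 … π_𝔮 = π_s»), stated as a conditional so that nothing beyond the displays is assumed: the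
parity lemma is the tree's `ShimuraData.exists_s_le_one` (p2's Parity.lean). -/
theorem DR2015Shape.exists_isAutomorphic_of_parities (S : DR2015Shape) (h : Hyp.DR2015_Thm3_2 S)
    (l : S.HeckeChar) (n : S.NormOneChar) (hΞ : S.InXi l n)
    (hpar : ∀ s ≤ 1, ∃ π ∈ S.Pi l n, S.sCount l n π = s) :
    ∃ π ∈ S.Pi l n, S.IsAutomorphic π ∧ S.m π = 1 := by
  obtain ⟨s, hs, hcond⟩ := ShimuraData.exists_s_le_one (S.W l n) (S.d - 1)
  obtain ⟨π, hmem, hsπ⟩ := hpar s hs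
  have hiii := h.2.2.1 l n hΞ π hmem
  have haut : S.IsAutomorphic π := hiii.1.2 (by rw [hsπ]; exact hcond)
  exact ⟨π, hmem, haut, hiii.2 haut⟩

end Summit.Ventures.HodgeRepro2.Tier7
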